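import Mathlib.RingTheory.Polynomial.Bernstein
import Mathlib.Analysis.SpecialFunctions.Pow.Real
import HarnessLib

/-!
# Bernstein range enclosure (Cargo–Shisha): sign certificates for polynomials on a segment / a box

Topic `Literature/Analysis/ValidatedNumerics`. The RANGE-ENCLOSING PROPERTY of the Bernstein expansion —
J. Garloff and A. P. Smith, *Solution of systems of polynomial equations by using Bernstein expansion*,
in Alefeld–Rohn–Rump–Yamamoto (eds.), *Symbolic Algebraic Methods and Verification Methods* (Springer,
Wien 2001) 87–97, §2.1 Lemma 1 (i) eq. (3) (the property is due to Cargo–Shisha 1966): if a polynomial is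
written in the Bernstein basis of degree `N` on the unit box `U = [0,1]^l`,
`p(x) = Σ_{I ≤ N} b_I B_{N,I}(x)`, `B_{N,I}(x) = Π_k C(n_k,i_k) x_k^{i_k}(1 − x_k)^{n_k − i_k}`, then
`min_I b_I ≤ p(x) ≤ max_I b_I` for every `x ∈ U` — because the Bernstein basis polynomials are
nonnegative on `[0,1]` and sum to `1` (Mathlib: `bernsteinPolynomial`, `bernsteinPolynomial.sum`).

What a SIGN CERTIFICATE consumes (the polygon-inclusion legs «Ψ < 0 on every closed edge of P_in»,
«Ψ > 0 on every edge of P_out» and the transversality leg «∇Ψ·(x − A) − μΨ > 0 on a box» of the certnum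
−Δ* eigenvalue chain, pub/certnum/ode/DESIGN-pde.md §3.4′; any exact semialgebraic sign test): the
one-variable statements `bernstein_sum_eval_pos` / `_neg` / the two-sided `le_bernstein_sum_eval` /
`bernstein_sum_eval_le` on `[0,1]`, and the tensor-product (two-variable) statements
`le_bernstein_sum₂_eval` / `bernstein_sum₂_eval_pos` on `[0,1]²`. A certificate row then reads: «the
restriction of `Ψ` to the edge (resp. the box), as a polynomial in the unit parameter(s), EQUALS
`Σ b_i·B_{n,i}` (checked by `ring`) and all `b_i < 0` (`norm_num`)» ⇒ the sign claim. The affine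
re-parametrisation of a segment / box onto `[0,1]^l` and the subdivision (de Casteljau) strategy are the
certificate's business: each leaf interval carries its own coefficients. WHAT THIS IS NOT: the conversion
formula (2) power basis → Bernstein basis (a row verifies the identity instance by `ring` instead), the
sharpness clause of Lemma 1 (i), derivative formula (ii), convergence under subdivision. Everything is
PROVED; no named facts. [cite: GarloffSmith2001, §2.1 Lemma 1 (i) eq. (3)]
-/

noncomputable section

open Polynomial Finset Set

namespace Literature.Analysis.ValidatedNumerics

namespace Bernstein

/-- The Bernstein basis polynomial `B_{n,ν}(x) = C(n,ν) x^ν (1 − x)^{n−ν}` evaluated at a real `x`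
(Mathlib's `bernsteinPolynomial ℝ n ν`). [cite: GarloffSmith2001, §2.1 (definition of b_{n,i})] -/
theorem eval_eq (n ν : ℕ) (x : ℝ) :
    (bernsteinPolynomial ℝ n ν).eval x = (n.choose ν : ℝ) * x ^ ν * (1 - x) ^ (n - ν) := by
  simp [bernsteinPolynomial, Polynomial.eval_mul, Polynomial.eval_pow, Polynomial.eval_sub,
    Polynomial.eval_natCast]

/-- Bernstein basis polynomials are NONNEGATIVE on `[0, 1]`. [cite: GarloffSmith2001, §2.1 Lemma 1 (i) (proof ingredient)] -/
theorem eval_nonneg {n ν : ℕ} {x : ℝ} (hx : x ∈ Icc (0 : ℝ) 1) :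
    0 ≤ (bernsteinPolynomial ℝ n ν).eval x := by
  rw [eval_eq]
  have h0 : 0 ≤ x := hx.1
  have h1 : 0 ≤ 1 - x := by linarith [hx.2]
  positivity

/-- Bernstein basis polynomials of degree `n` SUM TO ONE at every point (partition of unity;
Mathlib `bernsteinPolynomial.sum`). [cite: GarloffSmith2001, §2.1 Lemma 1 (i) (proof ingredient)] -/
theorem sum_eval (n : ℕ) (x : ℝ) :
    ∑ ν ∈ range (n + 1), (bernsteinPolynomial ℝ n ν).eval x = 1 := by
  have h := congrArg (Polynomial.eval x) (bernsteinPolynomial.sum ℝ n)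
  simpa [Polynomial.eval_finsetSum] using h

/-- **Range enclosure, lower side** (Cargo–Shisha / Garloff–Smith Lemma 1 (i)): if every Bernstein
coefficient is `≥ m` then `m ≤ Σ_ν b_ν B_{n,ν}(x)` on `[0,1]`. [cite: GarloffSmith2001, §2.1 Lemma 1 (i) eq. (3)] -/
theorem le_bernstein_sum_eval {n : ℕ} {b : ℕ → ℝ} {m x : ℝ} (hx : x ∈ Icc (0 : ℝ) 1)
    (hb : ∀ ν ≤ n, m ≤ b ν) :
    m ≤ ∑ ν ∈ range (n + 1), b ν * (bernsteinPolynomial ℝ n ν).eval x := by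
  calc m = ∑ ν ∈ range (n + 1), m * (bernsteinPolynomial ℝ n ν).eval x := by
        rw [← Finset.mul_sum, sum_eval, mul_one]
    _ ≤ ∑ ν ∈ range (n + 1), b ν * (bernsteinPolynomial ℝ n ν).eval x := by
        refine Finset.sum_le_sum fun ν hν => ?_
        exact mul_le_mul_of_nonneg_right (hb ν (Nat.lt_succ_iff.mp (Finset.mem_range.mp hν))) (eval_nonneg hx)

/-- **Range enclosure, upper side**: if every Bernstein coefficient is `≤ M` then
`Σ_ν b_ν B_{n,ν}(x) ≤ M` on `[0,1]`. [cite: GarloffSmith2001, §2.1 Lemma 1 (i) eq. (3)] -/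
theorem bernstein_sum_eval_le {n : ℕ} {b : ℕ → ℝ} {M x : ℝ} (hx : x ∈ Icc (0 : ℝ) 1)
    (hb : ∀ ν ≤ n, b ν ≤ M) :
    ∑ ν ∈ range (n + 1), b ν * (bernsteinPolynomial ℝ n ν).eval x ≤ M := by
  calc ∑ ν ∈ range (n + 1), b ν * (bernsteinPolynomial ℝ n ν).eval x
        ≤ ∑ ν ∈ range (n + 1), M * (bernsteinPolynomial ℝ n ν).eval x := by
        refine Finset.sum_le_sum fun ν hν => ?_
        exact mul_le_mul_of_nonneg_right (hb ν (Nat.lt_succ_iff.mp (Finset.mem_range.mp hν))) (eval_nonneg hx)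
    _ = M := by rw [← Finset.mul_sum, sum_eval, mul_one]

/-- **Sign certificate (positive)**: all Bernstein coefficients `> 0` ⇒ the polynomial is `> 0` on
`[0,1]` (take `m = min b_ν`). Stated with an explicit positive floor `m` so that a certificate row is
decided by `norm_num`. [cite: GarloffSmith2001, §2.1 Lemma 1 (i) eq. (3)] -/
theorem bernstein_sum_eval_pos {n : ℕ} {b : ℕ → ℝ} {m x : ℝ} (hx : x ∈ Icc (0 : ℝ) 1) (hm : 0 < m)
    (hb : ∀ ν ≤ n, m ≤ b ν) :
    0 < ∑ ν ∈ range (n + 1), b ν * (bernsteinPolynomial ℝ n ν).eval x :=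
  lt_of_lt_of_le hm (le_bernstein_sum_eval hx hb)

/-- **Sign certificate (negative)**: all Bernstein coefficients `≤ −m < 0` ⇒ the polynomial is `< 0`
on `[0,1]`. [cite: GarloffSmith2001, §2.1 Lemma 1 (i) eq. (3)] -/
theorem bernstein_sum_eval_neg {n : ℕ} {b : ℕ → ℝ} {m x : ℝ} (hx : x ∈ Icc (0 : ℝ) 1) (hm : 0 < m)
    (hb : ∀ ν ≤ n, b ν ≤ -m) :
    ∑ ν ∈ range (n + 1), b ν * (bernsteinPolynomial ℝ n ν).eval x < 0 :=
  lt_of_le_of_lt (bernstein_sum_eval_le hx hb) (by linarith)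

/-- **Tensor-product (bivariate) range enclosure, lower side**: on the unit square, if every
coefficient `b_{ij} ≥ m` then `m ≤ Σ_i Σ_j b_{ij} B_{n,i}(x) B_{k,j}(y)`.
[cite: GarloffSmith2001, §2.1 Lemma 1 (i) eq. (3) (l = 2)] -/
theorem le_bernstein_sum₂_eval {n k : ℕ} {b : ℕ → ℕ → ℝ} {m x y : ℝ} (hx : x ∈ Icc (0 : ℝ) 1)
    (hy : y ∈ Icc (0 : ℝ) 1) (hb : ∀ i ≤ n, ∀ j ≤ k, m ≤ b i j) :
    m ≤ ∑ i ∈ range (n + 1), ∑ j ∈ range (k + 1),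
      b i j * ((bernsteinPolynomial ℝ n i).eval x * (bernsteinPolynomial ℝ k j).eval y) := by
  have inner : ∀ i ≤ n, m * (bernsteinPolynomial ℝ n i).eval x ≤
      ∑ j ∈ range (k + 1), b i j * ((bernsteinPolynomial ℝ n i).eval x * (bernsteinPolynomial ℝ k j).eval y) := by
    intro i hi
    have hrw : ∑ j ∈ range (k + 1), b i j * ((bernsteinPolynomial ℝ n i).eval x * (bernsteinPolynomial ℝ k j).eval y)
        = (bernsteinPolynomial ℝ n i).eval x * ∑ j ∈ range (k + 1), b i j * (bernsteinPolynomial ℝ k j).eval y := by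
      rw [Finset.mul_sum]; refine Finset.sum_congr rfl fun j _ => by ring
    rw [hrw, mul_comm]
    exact mul_le_mul_of_nonneg_left (le_bernstein_sum_eval hy (hb i hi)) (eval_nonneg hx)
  calc m = ∑ i ∈ range (n + 1), m * (bernsteinPolynomial ℝ n i).eval x := by
        rw [← Finset.mul_sum, sum_eval, mul_one]
    _ ≤ _ := Finset.sum_le_sum fun i hi => inner i (Nat.lt_succ_iff.mp (Finset.mem_range.mp hi))

/-- **Bivariate sign certificate (positive)**: a positive floor `m ≤ b_{ij}` for all `i ≤ n`, `j ≤ k`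
forces `Σ_{ij} b_{ij} B_{n,i}(x)B_{k,j}(y) > 0` on the unit square — the form used by a transversality /
box-positivity leg after an affine map of the box onto `[0,1]²`.
[cite: GarloffSmith2001, §2.1 Lemma 1 (i) eq. (3) (l = 2)] -/
theorem bernstein_sum₂_eval_pos {n k : ℕ} {b : ℕ → ℕ → ℝ} {m x y : ℝ} (hx : x ∈ Icc (0 : ℝ) 1)
    (hy : y ∈ Icc (0 : ℝ) 1) (hm : 0 < m) (hb : ∀ i ≤ n, ∀ j ≤ k, m ≤ b i j) :
    0 < ∑ i ∈ range (n + 1), ∑ j ∈ range (k + 1),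
      b i j * ((bernsteinPolynomial ℝ n i).eval x * (bernsteinPolynomial ℝ k j).eval y) :=
  lt_of_lt_of_le hm (le_bernstein_sum₂_eval hx hy hb)

/-- A degree-2 sanity instance of a sign certificate row: `p(t) = 1 − t + t²` has Bernstein
coefficients `(1, 1/2, 1)` on `[0,1]` (identity checked by `ring` after unfolding the basis), hence
`p > 0` on `[0,1]`. [cite: GarloffSmith2001, §2.1 Lemma 1 (i) (worked instance)] -/
example (t : ℝ) (ht : t ∈ Icc (0 : ℝ) 1) : 0 < 1 - t + t ^ 2 := by
  have hrepr : 1 - t + t ^ 2 = ∑ ν ∈ range (2 + 1),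
      (fun ν => if ν = 1 then (1 / 2 : ℝ) else 1) ν * (bernsteinPolynomial ℝ 2 ν).eval t := by
    simp only [Finset.sum_range_succ, Finset.sum_range_zero, eval_eq]
    norm_num [Nat.choose]
    ring
  rw [hrepr]
  exact bernstein_sum_eval_pos ht (m := 1 / 2) (by norm_num) fun ν _ => by
    by_cases h : ν = 1
    · simp [h]
    · simp [h]; norm_num

end Bernstein

end Literature.Analysis.ValidatedNumerics
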